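import Literature.Probability.Process.ItoTaylorSimple
import Literature.Probability.Process.ItoIntegralConstructionLimit
import Literature.Analysis.FunctionSpaces.YamadaWatanabeTestFunction
import Literature.Analysis.FunctionSpaces.ItoProcessesProofs
import Literature.Analysis.FunctionSpaces.SquaredBessel
import HarnessLib

/-!
# Pathwise uniqueness for squared Bessel processes (Yamada–Watanabe)

Discharge of the named fact `Literature.Analysis.FunctionSpaces.pathwiseUnique_squaredBessel` (`SquaredBessel.lean`): two
squared Bessel processes `Z, Z'` of the same dimension `δ` started at the same point `z₀`, driven
by the canonical Brownian motion `B = Literature.brownian` and adapted to its raw natural filtration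
`𝓕⁰ = Literature.brownianFiltration`, are indistinguishable under `preWienerMeasure` — Revuz–Yor,
Ch. XI, §1 ("for every `δ` and `x`, this equation has a unique strong solution") via Ch. IX,
Thm (3.5)(ii) (Yamada–Watanabe: `|σ(x) - σ(y)|² ≤ ρ(|x - y|)` with `∫_{0+} du/ρ(u) = ∞`; here
`σ(z) = 2√|z|`, `ρ(u) = 4u`).

## The proof (expectation form of the Yamada–Watanabe argument along elementary approximants)

(Revuz–Yor prove Thm (3.5) through local times — Le Gall's argument, Lemma (3.3), Cor. (3.4);
the test-function argument used here is the original one of Yamada–Watanabe (1971), Thm 1, with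
the smooth functions `F_ε` of `YamadaWatanabeTestFunction.lean` in place of their `φₙ`.)

The drifts cancel (`b ≡ δ`), so `Δ = Z - Z' = J - J'` is the difference of the two Itô
integrals, i.e. (by the characterisation `Literature.Probability.Process.IsItoIntegral`) the u.c.p. limit of the elementary
integrals `Yₙ = (Hₙ - Kₙ) · B` of the dyadic samples `Hₙ, Kₙ` (`SimpleProcess.sample`) of
`σ(Z), σ(Z')`. No Itô formula for `Δ` itself is available in the tree (nor can `Δ` be stopped at
hitting times in the raw filtration), so the Yamada–Watanabe functional is evaluated along
*elementary* processes: for a level `c`, let `Lₙ` be the simple process on the dyadic grid whose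
value on the cell after `tᵢ = i/2ⁿ` is `χᵢ (σ(Z_{tᵢ}) - σ(Z'_{tᵢ}))`, where `χᵢ = 1` iff
`|Z_{tⱼ}| + |Z'_{tⱼ}| ≤ c` for all `j ≤ i` (a **discrete, predictable cut-off**: `χᵢ` is
`𝓕⁰_{tᵢ}`-measurable, no optional times are needed). Then `|Lₙ| ≤ 4√c`,
`Lₙ(tᵢ)² ≤ 4 |Δ_{tᵢ}|` (the Hölder bound `(2√|x| - 2√|y|)² ≤ 4|x - y|`), and
`Xₙ = Lₙ · B` agrees with `Yₙ` up to the first bad grid point. The Itô–Taylor estimate in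
expectation (`SimpleProcess.ito_taylor_estimate_brownian`) applied to `Xₙ` and the smooth test
functions `F_ε` (`Literature.Analysis.FunctionSpaces.ywF`: `F_ε'' = 1/√(x² + ε²)`, `F_ε''(x)|x| ≤ 1`) gives

  `E[F_ε(Xₙ(T))] ≤ ½ ∑ᵢ Δᵢt · E[F_ε''(Xₙ(tᵢ)) Lₙ(tᵢ)²] + errₙ`
  `≤ 2T + 2Tη'/ε + (8cT/ε) P(sup_{s ≤ T} |Yₙ - Δ| ≥ η') + errₙ`,

because on `{χᵢ = 1}` one has `Xₙ(tᵢ) = Yₙ(tᵢ)` and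
`F_ε''(Yₙ(tᵢ)) · 4|Δ_{tᵢ}| ≤ 4 (1 + |Δ_{tᵢ} - Yₙ(tᵢ)|/ε)`. Markov's inequality and
`{|Δ_T| ≥ 2r} ⊆ {|Xₙ(T)| ≥ r} ∪ {bad grid point before T} ∪ {|Yₙ(T) - Δ_T| ≥ r}` then yield,
letting `n → ∞` (u.c.p. convergence), `η, η' → 0`, `ε → 0` (`F_ε(r) → ∞`) and `c → ∞`
(a.s. continuity of the paths), `P(|Δ_T| ≥ 2r) = 0`; indistinguishability follows from the
a.s. continuity of `Δ`. Everything is carried out on the progressive versions `dyadicReg Z`,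
`dyadicReg Z'` (jointly measurable, equal to `Z, Z'` on the a.s. event of continuous paths).

## References

* D. Revuz, M. Yor, *Continuous Martingales and Brownian Motion* (3rd ed., 1999), Ch. IX,
  Lemma (3.3), Cor. (3.4), Thm (3.5)(ii); Ch. XI, §1, p. 439 and Def. (1.1); Ch. IV,
  Thm (3.3) (Itô's formula) and Prop. (2.13).
* T. Yamada, S. Watanabe, *On the uniqueness of solutions of stochastic differential
  equations*, J. Math. Kyoto Univ. 11 (1971), 155–167, Thm 1 (the test-function argument).
-/

open MeasureTheory ProbabilityTheory Filter Finset
open scoped NNReal ENNReal Topology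

noncomputable section

namespace Literature.Analysis.FunctionSpaces

/-! ### The squared Bessel diffusion coefficient -/

/-- The diffusion coefficient `σ(z) = 2√|z|` of the squared Bessel SDE.
Revuz–Yor, *Continuous Martingales and Brownian Motion* (1999), Ch. XI, §1, Def. (1.1).
[folklore] -/
def besqσ (z : ℝ) : ℝ := 2 * Real.sqrt |z|

/-- `σ(z) = 2√|z|` is continuous. [folklore] -/
theorem continuous_besqσ : Continuous besqσ := by
  unfold besqσ
  fun_prop

/-- `σ ≥ 0`. [folklore] -/
theorem besqσ_nonneg (z : ℝ) : 0 ≤ besqσ z := by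
  unfold besqσ
  positivity

/-- `|σ(z)| ≤ 2√c` when `|z| ≤ c`. [folklore] -/
theorem abs_besqσ_le {z c : ℝ} (h : |z| ≤ c) : |besqσ z| ≤ 2 * Real.sqrt c := by
  rw [abs_of_nonneg (besqσ_nonneg z), besqσ]
  exact mul_le_mul_of_nonneg_left (Real.sqrt_le_sqrt h) zero_le_two

/-- **The Yamada–Watanabe (Hölder-`½`) bound** `(σ(x) - σ(y))² ≤ 4 |x - y|`.
Revuz–Yor, *Continuous Martingales and Brownian Motion* (1999), Ch. XI, §1, p. 439. [folklore] -/
theorem sq_besqσ_sub_le (x y : ℝ) : (besqσ x - besqσ y) ^ 2 ≤ 4 * |x - y| :=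
  sq_two_mul_sqrt_abs_sub_le x y

/-! ### u.c.p. convergence of differences -/

section UCP

variable {Ω : Type*} {m : MeasurableSpace Ω} {P : Measure Ω}

/-- u.c.p. convergence is compatible with differences. [folklore] -/
theorem _root_.Literature.Probability.Process.TendstoUCP.sub {Y Y' : ℕ → ℝ≥0 → Ω → ℝ} {J J' : ℝ≥0 → Ω → ℝ}
    (h : Literature.Probability.Process.TendstoUCP Y J P) (h' : Literature.Probability.Process.TendstoUCP Y' J' P) :
    Literature.Probability.Process.TendstoUCP (fun n t ω ↦ Y n t ω - Y' n t ω) (fun t ω ↦ J t ω - J' t ω) P := by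
  intro t ε hε
  have hε2 : 0 < ε / 2 := by positivity
  have hsub : ∀ n, {ω | ∃ s ≤ t, ε ≤ |(Y n s ω - Y' n s ω) - (J s ω - J' s ω)|} ⊆
      {ω | ∃ s ≤ t, ε / 2 ≤ |Y n s ω - J s ω|} ∪ {ω | ∃ s ≤ t, ε / 2 ≤ |Y' n s ω - J' s ω|} := by
    rintro n ω ⟨s, hs, hεs⟩
    by_contra hcon
    simp only [Set.mem_union, Set.mem_setOf_eq, not_or, not_exists, not_and, not_le] at hcon
    have h1 := hcon.1 s hs
    have h2 := hcon.2 s hs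
    have : |(Y n s ω - Y' n s ω) - (J s ω - J' s ω)| ≤ |Y n s ω - J s ω| + |Y' n s ω - J' s ω| := by
      calc |(Y n s ω - Y' n s ω) - (J s ω - J' s ω)|
          = |(Y n s ω - J s ω) - (Y' n s ω - J' s ω)| := by ring_nf
        _ ≤ _ := abs_sub _ _
    linarith
  have hlim := (h t _ hε2).add (h' t _ hε2)
  rw [add_zero] at hlim
  exact tendsto_of_tendsto_of_tendsto_of_le_of_le tendsto_const_nhds hlim (fun _ ↦ bot_le)
    fun n ↦ (measure_mono (hsub n)).trans (measure_union_le _ _)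

end UCP

/-! ### Simple processes on the dyadic grid -/

section SimpleProcess
open Literature.Probability.Process (SimpleProcess)
open Literature.Probability.Process.SimpleProcess

variable {Ω : Type*} {m : MeasurableSpace Ω} {𝓕 : Filtration ℝ≥0 m}

/-- The bounded simple process on the dyadic grid `k/2ⁿ`, `k ≤ n 2ⁿ`, with prescribed
(`𝓕_{k/2ⁿ}`-measurable, uniformly bounded) values on the cells `(k/2ⁿ, (k+1)/2ⁿ]`.
Revuz–Yor, *Continuous Martingales and Brownian Motion* (1999), Ch. IV, Def. (2.3). [folklore] -/
def _root_.Literature.Probability.Process.SimpleProcess.onDyadic (n : ℕ) (v : ℕ → Ω → ℝ)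
    (hv : ∀ k : ℕ, StronglyMeasurable[𝓕 ((k : ℝ≥0) / 2 ^ n)] (v k))
    (hb : ∃ C, ∀ k ω, |v k ω| ≤ C) : SimpleProcess m 𝓕 where
  times := Literature.Probability.Process.dyadicTimes n
  sorted := Literature.Probability.Process.sortedLT_dyadicTimes n
  value := v
  measurable k hk := by
    have heq : (Literature.Probability.Process.dyadicTimes n).get ⟨k, hk⟩ = (k : ℝ≥0) / 2 ^ n := Literature.Probability.Process.getElem_dyadicTimes n hk
    rw [heq]
    exact hv k
  bounded := hb

/-- The values of `onDyadic`. [folklore] -/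
@[simp] theorem _root_.Literature.Probability.Process.SimpleProcess.onDyadic_value (n : ℕ) (v : ℕ → Ω → ℝ)
    (hv : ∀ k : ℕ, StronglyMeasurable[𝓕 ((k : ℝ≥0) / 2 ^ n)] (v k)) (hb : ∃ C, ∀ k ω, |v k ω| ≤ C) :
    (onDyadic n v hv hb).value = v := rfl

/-- The partition of `onDyadic` is the dyadic grid. [folklore] -/
@[simp] theorem _root_.Literature.Probability.Process.SimpleProcess.onDyadic_times (n : ℕ) (v : ℕ → Ω → ℝ)
    (hv : ∀ k : ℕ, StronglyMeasurable[𝓕 ((k : ℝ≥0) / 2 ^ n)] (v k)) (hb : ∃ C, ∀ k ω, |v k ω| ≤ C) :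
    (onDyadic n v hv hb).times = Literature.Probability.Process.dyadicTimes n := rfl

/-- The partition times of a simple process on the dyadic grid. [folklore] -/
theorem _root_.Literature.Probability.Process.SimpleProcess.time_of_times_eq_dyadicTimes (H : SimpleProcess m 𝓕) {n : ℕ} (h : H.times = Literature.Probability.Process.dyadicTimes n)
    {k : ℕ} (hk : k < n * 2 ^ n + 1) : H.time k = (k : ℝ≥0) / 2 ^ n := by
  rw [time_eq_getElem _ (by rw [h]; simpa using hk)]
  simp only [h]
  exact Literature.Probability.Process.getElem_dyadicTimes n _

/-- **Elementary integrals only see the values on cells that have started**: if three simple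
processes share their partition and `P = Q - R` valuewise on every cell `(tᵢ, tᵢ₊₁]` with
`tᵢ < t`, then `(P·B)_t = (Q·B)_t - (R·B)_t` (at the given `ω`).
Revuz–Yor, *Continuous Martingales and Brownian Motion* (1999), Ch. IV, §2, after Def. (2.3).
[folklore] -/
theorem _root_.Literature.Probability.Process.SimpleProcess.integral_eq_sub_of_forall_value {P Q R : SimpleProcess m 𝓕} (hPQ : Q.times = P.times)
    (hPR : R.times = P.times) (B : ℝ≥0 → Ω → ℝ) {t : ℝ≥0} {ω : Ω}
    (h : ∀ i, i + 1 < P.times.length → P.time i < t →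
      P.value i ω = Q.value i ω - R.value i ω) :
    P.integral B t ω = Q.integral B t ω - R.integral B t ω := by
  have htQ : ∀ i, Q.time i = P.time i := fun i ↦ by simp only [SimpleProcess.time, hPQ]
  have htR : ∀ i, R.time i = P.time i := fun i ↦ by simp only [SimpleProcess.time, hPR]
  rw [P.integral_apply_eq_sum_summand, Q.integral_apply_eq_sum_summand,
    R.integral_apply_eq_sum_summand, hPQ, hPR, ← sum_sub_distrib]
  refine sum_congr rfl fun i hi ↦ ?_
  have hi' : i + 1 < P.times.length := by have := mem_range.1 hi; omega
  simp only [summand_apply, htQ, htR]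
  by_cases hti : P.time i < t
  · rw [h i hi' hti]
    ring
  · push Not at hti
    have h1 : min t (P.time (i + 1)) = t := min_eq_left (hti.trans (P.time_mono (Nat.le_succ i) hi'))
    have h0 : min t (P.time i) = t := min_eq_left hti
    rw [h1, h0, sub_self, mul_zero, mul_zero, mul_zero, sub_self]

end SimpleProcess

/-! ### The discrete cut-off and the stopped difference process -/

section Cutoff

variable {Ω : Type*} {m : MeasurableSpace Ω} {𝓕 : Filtration ℝ≥0 m}
  (X X' : ℝ≥0 → Ω → ℝ)

/-- `GoodUpTo X X' c n k ω`: all dyadic grid points `j/2ⁿ`, `j ≤ k`, have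
`|X_{j/2ⁿ}(ω)| + |X'_{j/2ⁿ}(ω)| ≤ c` (the discrete, predictable substitute for
`{T_c > k/2ⁿ}`, `T_c` the exit time of level `c`).
Revuz–Yor, *Continuous Martingales and Brownian Motion* (1999), Ch. IX, proof of Thm (3.5)(ii)
(localisation at the stopping times `Tₙ`); Yamada–Watanabe (1971), proof of Thm 1. [folklore] -/
def GoodUpTo (c : ℝ) (n k : ℕ) (ω : Ω) : Prop :=
  ∀ j ≤ k, |X ((j : ℝ≥0) / 2 ^ n) ω| + |X' ((j : ℝ≥0) / 2 ^ n) ω| ≤ c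

/-- `GoodUpTo` is monotone (decreasing) in the index. [folklore] -/
theorem GoodUpTo.mono {c : ℝ} {n k i : ℕ} {ω : Ω} (h : GoodUpTo X X' c n k ω) (hik : i ≤ k) :
    GoodUpTo X X' c n i ω := fun j hj ↦ h j (hj.trans hik)

/-- On `GoodUpTo … k` the two processes are bounded by `c` at `k/2ⁿ`. [folklore] -/
theorem GoodUpTo.abs_le {c : ℝ} {n k : ℕ} {ω : Ω} (h : GoodUpTo X X' c n k ω) :
    |X ((k : ℝ≥0) / 2 ^ n) ω| ≤ c ∧ |X' ((k : ℝ≥0) / 2 ^ n) ω| ≤ c := by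
  have := h k le_rfl
  exact ⟨by linarith [abs_nonneg (X' ((k : ℝ≥0) / 2 ^ n) ω)],
    by linarith [abs_nonneg (X ((k : ℝ≥0) / 2 ^ n) ω)]⟩

/-- The good event is `𝓕_{k/2ⁿ}`-measurable for adapted processes. [folklore] -/
theorem measurableSet_goodUpTo (hX : Adapted 𝓕 X) (hX' : Adapted 𝓕 X') (c : ℝ) (n k : ℕ) :
    MeasurableSet[𝓕 ((k : ℝ≥0) / 2 ^ n)] {ω | GoodUpTo X X' c n k ω} := by
  have : {ω | GoodUpTo X X' c n k ω} =
      ⋂ j ∈ Finset.range (k + 1), {ω | |X ((j : ℝ≥0) / 2 ^ n) ω| + |X' ((j : ℝ≥0) / 2 ^ n) ω| ≤ c} := by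
    ext ω
    simp only [GoodUpTo, Set.mem_setOf_eq, Set.mem_iInter, Finset.mem_range, Nat.lt_succ_iff]
  rw [this]
  refine MeasurableSet.biInter (Set.to_countable _) fun j hj ↦ ?_
  have hj' : j ≤ k := Nat.lt_succ_iff.1 (Finset.mem_range.1 hj)
  have hle : (j : ℝ≥0) / 2 ^ n ≤ (k : ℝ≥0) / 2 ^ n :=
    div_le_div_of_nonneg_right (by exact_mod_cast hj') (pow_pos two_pos n).le
  have h1 : Measurable[𝓕 ((k : ℝ≥0) / 2 ^ n)] (X ((j : ℝ≥0) / 2 ^ n)) :=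
    (hX _).mono (𝓕.mono hle) le_rfl
  have h2 : Measurable[𝓕 ((k : ℝ≥0) / 2 ^ n)] (X' ((j : ℝ≥0) / 2 ^ n)) :=
    (hX' _).mono (𝓕.mono hle) le_rfl
  have h : StronglyMeasurable[𝓕 ((k : ℝ≥0) / 2 ^ n)]
      (fun ω ↦ |X ((j : ℝ≥0) / 2 ^ n) ω| + |X' ((j : ℝ≥0) / 2 ^ n) ω|) :=
    (continuous_abs.comp_stronglyMeasurable h1.stronglyMeasurable).add
      (continuous_abs.comp_stronglyMeasurable h2.stronglyMeasurable)
  exact h.measurable measurableSet_Iic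

/-- The cut-off `χₖ = 𝟙_{GoodUpTo … k}`. [folklore] -/
def cutoff (c : ℝ) (n k : ℕ) : Ω → ℝ := {ω | GoodUpTo X X' c n k ω}.indicator 1

/-- The cut-off is `1` on the good event. [folklore] -/
theorem cutoff_eq_one {c : ℝ} {n k : ℕ} {ω : Ω} (h : GoodUpTo X X' c n k ω) :
    cutoff X X' c n k ω = 1 :=
  Set.indicator_of_mem (show ω ∈ {ω | GoodUpTo X X' c n k ω} from h) _

/-- The cut-off is `0` off the good event. [folklore] -/
theorem cutoff_eq_zero {c : ℝ} {n k : ℕ} {ω : Ω} (h : ¬ GoodUpTo X X' c n k ω) :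
    cutoff X X' c n k ω = 0 :=
  Set.indicator_of_notMem (show ω ∉ {ω | GoodUpTo X X' c n k ω} from h) _

/-- The cut-off is `𝓕_{k/2ⁿ}`-strongly measurable. [folklore] -/
theorem stronglyMeasurable_cutoff (hX : Adapted 𝓕 X) (hX' : Adapted 𝓕 X') (c : ℝ) (n k : ℕ) :
    StronglyMeasurable[𝓕 ((k : ℝ≥0) / 2 ^ n)] (cutoff X X' c n k) := by
  refine StronglyMeasurable.indicator ?_ (measurableSet_goodUpTo X X' hX hX' c n k)
  exact stronglyMeasurable_const

variable (c : ℝ) (n : ℕ)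

/-- The value of the stopped difference process on the cell after `k/2ⁿ`:
`χₖ (σ(X_{k/2ⁿ}) - σ(X'_{k/2ⁿ}))`. [folklore] -/
def stopDiffValue (k : ℕ) (ω : Ω) : ℝ :=
  cutoff X X' c n k ω * (besqσ (X ((k : ℝ≥0) / 2 ^ n) ω) - besqσ (X' ((k : ℝ≥0) / 2 ^ n) ω))

/-- The values of the stopped difference process are bounded by `4√c`. [folklore] -/
theorem abs_stopDiffValue_le (k : ℕ) (ω : Ω) : |stopDiffValue X X' c n k ω| ≤ 4 * Real.sqrt c := by
  unfold stopDiffValue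
  by_cases h : GoodUpTo X X' c n k ω
  · obtain ⟨h1, h2⟩ := GoodUpTo.abs_le X X' h
    rw [cutoff_eq_one X X' h, one_mul]
    calc _ ≤ |besqσ (X ((k : ℝ≥0) / 2 ^ n) ω)| + |besqσ (X' ((k : ℝ≥0) / 2 ^ n) ω)| := abs_sub _ _
      _ ≤ 2 * Real.sqrt c + 2 * Real.sqrt c := add_le_add (abs_besqσ_le h1) (abs_besqσ_le h2)
      _ = 4 * Real.sqrt c := by ring
  · rw [cutoff_eq_zero X X' h, zero_mul, abs_zero]
    positivity

/-- **The Hölder bound on the stopped values**: `χₖ² (σ(X) - σ(X'))² ≤ 4 χₖ |X - X'|` at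
`k/2ⁿ`. Revuz–Yor, *Continuous Martingales and Brownian Motion* (1999), Ch. IX, Thm (3.5)(ii)
(`|σ(x) - σ(y)|² ≤ ρ(|x - y|)`). [folklore] -/
theorem stopDiffValue_sq_le (k : ℕ) (ω : Ω) :
    stopDiffValue X X' c n k ω ^ 2 ≤
      cutoff X X' c n k ω * (4 * |X ((k : ℝ≥0) / 2 ^ n) ω - X' ((k : ℝ≥0) / 2 ^ n) ω|) := by
  unfold stopDiffValue
  by_cases h : GoodUpTo X X' c n k ω
  · rw [cutoff_eq_one X X' h, one_mul, one_mul]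
    exact sq_besqσ_sub_le _ _
  · simp [cutoff_eq_zero X X' h]

/-- The cut-off takes the values `0` and `1` only; in particular it is nonnegative. [folklore] -/
theorem cutoff_nonneg (k : ℕ) (ω : Ω) : 0 ≤ cutoff X X' c n k ω := by
  by_cases h : GoodUpTo X X' c n k ω
  · rw [cutoff_eq_one X X' h]; norm_num
  · rw [cutoff_eq_zero X X' h]

/-- The cut-off is at most `1`. [folklore] -/
theorem cutoff_le_one (k : ℕ) (ω : Ω) : cutoff X X' c n k ω ≤ 1 := by
  by_cases h : GoodUpTo X X' c n k ω
  · rw [cutoff_eq_one X X' h]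
  · rw [cutoff_eq_zero X X' h]; norm_num

/-- **The stopped difference process** `Lₙ`: the simple process on the dyadic grid with value
`χₖ (σ(X_{k/2ⁿ}) - σ(X'_{k/2ⁿ}))` on `(k/2ⁿ, (k+1)/2ⁿ]`.
Revuz–Yor, *Continuous Martingales and Brownian Motion* (1999), Ch. IX, proof of Thm (3.5)(ii)
(the stopped solutions `Yⁱ = (Xⁱ)^{Tₙ}`; elementary version of `Y¹ - Y²`). [folklore] -/
def stopDiff (hX : Adapted 𝓕 X) (hX' : Adapted 𝓕 X') : Literature.Probability.Process.SimpleProcess m 𝓕 :=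
  Literature.Probability.Process.SimpleProcess.onDyadic n (stopDiffValue X X' c n)
    (fun k ↦ (stronglyMeasurable_cutoff X X' hX hX' c n k).mul
      ((continuous_besqσ.measurable.comp (hX _)).stronglyMeasurable.sub
        (continuous_besqσ.measurable.comp (hX' _)).stronglyMeasurable))
    ⟨4 * Real.sqrt c, abs_stopDiffValue_le X X' c n⟩

/-- The values of the stopped difference process. [folklore] -/
@[simp] theorem stopDiff_value (hX : Adapted 𝓕 X) (hX' : Adapted 𝓕 X') :
    (stopDiff X X' c n hX hX').value = stopDiffValue X X' c n := rfl

/-- The partition of the stopped difference process. [folklore] -/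
@[simp] theorem stopDiff_times (hX : Adapted 𝓕 X) (hX' : Adapted 𝓕 X') :
    (stopDiff X X' c n hX hX').times = Literature.Probability.Process.dyadicTimes n := rfl

/-- The composed integrands `σ(X)`, `σ(X')` are adapted. [folklore] -/
theorem adapted_besqσ_comp (hX : Adapted 𝓕 X) : Adapted 𝓕 fun t ω ↦ besqσ (X t ω) :=
  fun t ↦ continuous_besqσ.measurable.comp (hX t)

/-- **The stopped difference agrees with the difference of the samples before the first bad
grid point**: if all grid points `i/2ⁿ < t` are good and `2√c ≤ n` (so that the clamping in
`SimpleProcess.sample` is inactive there), then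
`(Lₙ·B)_t = (sample(σ∘X)ₙ·B)_t - (sample(σ∘X')ₙ·B)_t`. [folklore] -/
theorem integral_stopDiff_eq (hX : Adapted 𝓕 X) (hX' : Adapted 𝓕 X') {t : ℝ≥0} {ω : Ω}
    (hcn : 2 * Real.sqrt c ≤ n) (hgood : ∀ i : ℕ, ((i : ℝ≥0) / 2 ^ n) < t → GoodUpTo X X' c n i ω)
    (B : ℝ≥0 → Ω → ℝ) :
    (stopDiff X X' c n hX hX').integral B t ω =
      (Literature.Probability.Process.SimpleProcess.sample (fun t ω ↦ besqσ (X t ω)) (adapted_besqσ_comp X hX) n).integral B t ω -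
      (Literature.Probability.Process.SimpleProcess.sample (fun t ω ↦ besqσ (X' t ω)) (adapted_besqσ_comp X' hX') n).integral
        B t ω := by
  refine Literature.Probability.Process.SimpleProcess.integral_eq_sub_of_forall_value (P := stopDiff X X' c n hX hX')
    (Q := Literature.Probability.Process.SimpleProcess.sample (fun t ω ↦ besqσ (X t ω)) (adapted_besqσ_comp X hX) n)
    (R := Literature.Probability.Process.SimpleProcess.sample (fun t ω ↦ besqσ (X' t ω)) (adapted_besqσ_comp X' hX') n)
    rfl rfl B fun i hi hti ↦ ?_
  have hlen : i < n * 2 ^ n + 1 := by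
    have : (stopDiff X X' c n hX hX').times.length = n * 2 ^ n + 1 := by simp
    omega
  rw [(stopDiff X X' c n hX hX').time_of_times_eq_dyadicTimes rfl hlen] at hti
  have hg := hgood i hti
  obtain ⟨h1, h2⟩ := GoodUpTo.abs_le X X' hg
  simp only [stopDiff_value, stopDiffValue, cutoff_eq_one X X' hg, one_mul,
    Literature.Probability.Process.SimpleProcess.sample_value]
  rw [Literature.Probability.Process.clamp_eq_self ((abs_besqσ_le h1).trans hcn), Literature.Probability.Process.clamp_eq_self ((abs_besqσ_le h2).trans hcn)]

end Cutoff

/-! ### The core estimate on the canonical space -/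

section Core

variable {X X' : ℝ≥0 → (ℝ≥0 → ℝ) → ℝ}

/-- The elementary integrals of the differences of the samples: `Yₙ = (Hₙ·B) - (Kₙ·B)`.
[folklore] -/
def sampleDiffIntegral (hX : Adapted Literature.Probability.RandomPlanarGeometry.brownianFiltration X) (hX' : Adapted Literature.Probability.RandomPlanarGeometry.brownianFiltration X')
    (n : ℕ) : ℝ≥0 → (ℝ≥0 → ℝ) → ℝ := fun t ω ↦
  (Literature.Probability.Process.SimpleProcess.sample (fun t ω ↦ besqσ (X t ω)) (adapted_besqσ_comp X hX) n).integral
      Literature.Probability.Process.brownian t ω -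
    (Literature.Probability.Process.SimpleProcess.sample (fun t ω ↦ besqσ (X' t ω)) (adapted_besqσ_comp X' hX') n).integral
      Literature.Probability.Process.brownian t ω

/-- `Yₙ(t)` is measurable. [folklore] -/
theorem measurable_sampleDiffIntegral (hX : Adapted Literature.Probability.RandomPlanarGeometry.brownianFiltration X)
    (hX' : Adapted Literature.Probability.RandomPlanarGeometry.brownianFiltration X') (n : ℕ) (t : ℝ≥0) :
    Measurable (sampleDiffIntegral hX hX' n t) :=
  ((Literature.Probability.Process.martingale_integral_brownian _).stronglyAdapted t).measurable.mono (Literature.Probability.RandomPlanarGeometry.brownianFiltration.le t)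
    le_rfl |>.sub <|
  ((Literature.Probability.Process.martingale_integral_brownian _).stronglyAdapted t).measurable.mono (Literature.Probability.RandomPlanarGeometry.brownianFiltration.le t)
    le_rfl

/-- **The pointwise Yamada–Watanabe bound on one cell.** With `Lₙ` the stopped difference,
`Xₙ = Lₙ·B`, `Yₙ` the difference of the sample integrals, `D = X - X'`, `tₖ = k/2ⁿ` and
`2√c ≤ n`: for every `η' > 0`,
`F_ε''(Xₙ(tₖ)) Lₙ(tₖ)² ≤ 4 + 4η'/ε` if `|D(tₖ) - Yₙ(tₖ)| < η'`, and `≤ 16c/ε` always.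
[folklore] -/
theorem ywF''_mul_stopDiffValue_sq_le (hX : Adapted Literature.Probability.RandomPlanarGeometry.brownianFiltration X)
    (hX' : Adapted Literature.Probability.RandomPlanarGeometry.brownianFiltration X') {c ε : ℝ} (hc : 0 ≤ c) (hε : 0 < ε) {n : ℕ}
    (hcn : 2 * Real.sqrt c ≤ n) (k : ℕ) (ω : ℝ≥0 → ℝ) :
    ywF'' ε ((stopDiff X X' c n hX hX').integral Literature.Probability.Process.brownian ((k : ℝ≥0) / 2 ^ n) ω) *
        stopDiffValue X X' c n k ω ^ 2 ≤
      4 + 4 * |(X ((k : ℝ≥0) / 2 ^ n) ω - X' ((k : ℝ≥0) / 2 ^ n) ω) -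
        sampleDiffIntegral hX hX' n ((k : ℝ≥0) / 2 ^ n) ω| / ε ∧
    ywF'' ε ((stopDiff X X' c n hX hX').integral Literature.Probability.Process.brownian ((k : ℝ≥0) / 2 ^ n) ω) *
        stopDiffValue X X' c n k ω ^ 2 ≤ 16 * c / ε := by
  set x := (stopDiff X X' c n hX hX').integral Literature.Probability.Process.brownian ((k : ℝ≥0) / 2 ^ n) ω with hx
  have hF0 := ywF''_pos hε x
  have hFle := ywF''_le hε x
  constructor
  · by_cases hg : GoodUpTo X X' c n k ω
    · -- good cell: `Xₙ(tₖ) = Yₙ(tₖ)` and the key inequality at a nearby point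
      have heq : x = sampleDiffIntegral hX hX' n ((k : ℝ≥0) / 2 ^ n) ω := by
        simp only [hx, sampleDiffIntegral]
        refine integral_stopDiff_eq X X' c n hX hX' hcn (fun i hi ↦ hg.mono X X' ?_) Literature.Probability.Process.brownian
        have h2 : (0 : ℝ≥0) < 2 ^ n := pow_pos two_pos n
        have : (i : ℝ≥0) < k := (div_lt_div_iff_of_pos_right h2).1 hi
        exact_mod_cast this.le
      have h1 := stopDiffValue_sq_le X X' c n k ω
      rw [cutoff_eq_one X X' hg, one_mul] at h1
      have key := ywF''_mul_abs_le hε x (X ((k : ℝ≥0) / 2 ^ n) ω - X' ((k : ℝ≥0) / 2 ^ n) ω)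
      rw [← heq]
      calc ywF'' ε x * stopDiffValue X X' c n k ω ^ 2
          ≤ ywF'' ε x * (4 * |X ((k : ℝ≥0) / 2 ^ n) ω - X' ((k : ℝ≥0) / 2 ^ n) ω|) :=
            mul_le_mul_of_nonneg_left h1 hF0.le
        _ = 4 * (ywF'' ε x * |X ((k : ℝ≥0) / 2 ^ n) ω - X' ((k : ℝ≥0) / 2 ^ n) ω|) := by ring
        _ ≤ 4 * (1 + |X ((k : ℝ≥0) / 2 ^ n) ω - X' ((k : ℝ≥0) / 2 ^ n) ω - x| / ε) := by gcongr
        _ = _ := by ring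
    · have h0 : stopDiffValue X X' c n k ω = 0 := by simp [stopDiffValue, cutoff_eq_zero X X' hg]
      rw [h0]
      simp only [ne_eq, OfNat.ofNat_ne_zero, not_false_eq_true, zero_pow, mul_zero]
      positivity
  · have h1 : stopDiffValue X X' c n k ω ^ 2 ≤ 16 * c := by
      have h := abs_stopDiffValue_le X X' c n k ω
      have hs : 0 ≤ Real.sqrt c := Real.sqrt_nonneg c
      calc stopDiffValue X X' c n k ω ^ 2 = |stopDiffValue X X' c n k ω| ^ 2 := (sq_abs _).symm
        _ ≤ (4 * Real.sqrt c) ^ 2 := pow_le_pow_left₀ (abs_nonneg _) h 2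
        _ = 16 * c := by rw [mul_pow, Real.sq_sqrt hc]; ring
    calc _ ≤ ε⁻¹ * (16 * c) := mul_le_mul hFle h1 (sq_nonneg _) (by positivity)
      _ = 16 * c / ε := by ring

/-! #### Measurability and moments of the stopped values -/

/-- The stopped values are measurable. [folklore] -/
theorem measurable_stopDiffValue (hX : Adapted Literature.Probability.RandomPlanarGeometry.brownianFiltration X)
    (hX' : Adapted Literature.Probability.RandomPlanarGeometry.brownianFiltration X') (c : ℝ) (n k : ℕ) :
    Measurable (stopDiffValue X X' c n k) :=
  ((stronglyMeasurable_cutoff X X' hX hX' c n k).measurable.mono (Literature.Probability.RandomPlanarGeometry.brownianFiltration.le _)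
    le_rfl).mul
    ((continuous_besqσ.measurable.comp ((hX _).mono (Literature.Probability.RandomPlanarGeometry.brownianFiltration.le _) le_rfl)).sub
      (continuous_besqσ.measurable.comp ((hX' _).mono (Literature.Probability.RandomPlanarGeometry.brownianFiltration.le _) le_rfl)))

/-- `E[Lₙ(tₖ)²] ≤ 16 c`. [folklore] -/
theorem integral_stopDiffValue_sq_le {c : ℝ} (hc : 0 ≤ c) (n k : ℕ) :
    ∫ ω, stopDiffValue X X' c n k ω ^ 2 ∂Literature.Probability.Process.preWienerMeasure ≤ 16 * c := by
  haveI := Literature.Probability.RandomPlanarGeometry.isProbabilityMeasure_preWienerMeasure'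
  have hb : ∀ ω, stopDiffValue X X' c n k ω ^ 2 ≤ 16 * c := fun ω ↦ by
    have h := abs_stopDiffValue_le X X' c n k ω
    calc stopDiffValue X X' c n k ω ^ 2 = |stopDiffValue X X' c n k ω| ^ 2 := (sq_abs _).symm
      _ ≤ (4 * Real.sqrt c) ^ 2 := pow_le_pow_left₀ (abs_nonneg _) h 2
      _ = 16 * c := by rw [mul_pow, Real.sq_sqrt hc]; ring
  calc ∫ ω, stopDiffValue X X' c n k ω ^ 2 ∂Literature.Probability.Process.preWienerMeasure
      ≤ ∫ _, 16 * c ∂Literature.Probability.Process.preWienerMeasure := by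
        refine integral_mono_of_nonneg (ae_of_all _ fun ω ↦ sq_nonneg _) (integrable_const _)
          (ae_of_all _ hb)
    _ = 16 * c := by simp

/-- `E[Lₙ(tₖ)⁴] ≤ 256 c²`. [folklore] -/
theorem integral_stopDiffValue_pow_four_le {c : ℝ} (hc : 0 ≤ c) (n k : ℕ) :
    ∫ ω, stopDiffValue X X' c n k ω ^ 4 ∂Literature.Probability.Process.preWienerMeasure ≤ 256 * c ^ 2 := by
  haveI := Literature.Probability.RandomPlanarGeometry.isProbabilityMeasure_preWienerMeasure'
  have hb : ∀ ω, stopDiffValue X X' c n k ω ^ 4 ≤ 256 * c ^ 2 := fun ω ↦ by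
    have h := abs_stopDiffValue_le X X' c n k ω
    calc stopDiffValue X X' c n k ω ^ 4 = |stopDiffValue X X' c n k ω| ^ 4 := by
          rw [← abs_pow, abs_of_nonneg (by positivity)]
      _ ≤ (4 * Real.sqrt c) ^ 4 := pow_le_pow_left₀ (abs_nonneg _) h 4
      _ = 256 * (Real.sqrt c ^ 2) ^ 2 := by ring
      _ = 256 * c ^ 2 := by rw [Real.sq_sqrt hc]
  calc ∫ ω, stopDiffValue X X' c n k ω ^ 4 ∂Literature.Probability.Process.preWienerMeasure
      ≤ ∫ _, 256 * c ^ 2 ∂Literature.Probability.Process.preWienerMeasure := by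
        refine integral_mono_of_nonneg (ae_of_all _ fun ω ↦ by positivity) (integrable_const _)
          (ae_of_all _ hb)
    _ = 256 * c ^ 2 := by simp

/-- `Xₙ(t) = (Lₙ·B)_t` is measurable. [folklore] -/
theorem measurable_integral_stopDiff (hX : Adapted Literature.Probability.RandomPlanarGeometry.brownianFiltration X)
    (hX' : Adapted Literature.Probability.RandomPlanarGeometry.brownianFiltration X') (c : ℝ) (n : ℕ) (t : ℝ≥0) :
    Measurable ((stopDiff X X' c n hX hX').integral Literature.Probability.Process.brownian t) :=
  ((Literature.Probability.Process.martingale_integral_brownian _).stronglyAdapted t).measurable.mono (Literature.Probability.RandomPlanarGeometry.brownianFiltration.le t)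
    le_rfl

/-- `F_ε''` is continuous. [folklore] -/
theorem continuous_ywF'' {ε : ℝ} (hε : 0 < ε) : Continuous (ywF'' ε) :=
  continuous_iff_continuousAt.2 fun x ↦ (hasDerivAt_ywF'' hε x).continuousAt

/-! #### The expectation bound -/

/-- **Expectation of the Yamada–Watanabe density on one cell**: for `tₖ = k/2ⁿ ≤ T`,
`E[F_ε''(Xₙ(tₖ)) Lₙ(tₖ)²] ≤ 4 + 4η'/ε + (16c/ε) P(sup_{s ≤ T} |Yₙ(s) - D(s)| ≥ η')`.
Yamada–Watanabe (1971), proof of Thm 1 (`E ∫₀ᵗ φₙ''(X_s) (σ(X¹_s) - σ(X²_s))² ds ≤ t/n` for the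
test functions `φₙ` with `φₙ'' ρ ≤ 2/n`; here `F_ε''(x) · 4|x| ≤ 4`); the `ρ`-hypothesis is that of
Revuz–Yor (1999), Ch. IX, Cor. (3.4)/Thm (3.5)(ii). [folklore] -/
theorem integral_ywF''_mul_stopDiffValue_sq_le (hX : Adapted Literature.Probability.RandomPlanarGeometry.brownianFiltration X)
    (hX' : Adapted Literature.Probability.RandomPlanarGeometry.brownianFiltration X') {c ε η' : ℝ} (hc : 0 ≤ c) (hε : 0 < ε) (hη' : 0 < η')
    {n : ℕ} (hcn : 2 * Real.sqrt c ≤ n) {T : ℝ≥0} {k : ℕ} (hk : (k : ℝ≥0) / 2 ^ n ≤ T) :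
    ∫ ω, ywF'' ε ((stopDiff X X' c n hX hX').integral Literature.Probability.Process.brownian ((k : ℝ≥0) / 2 ^ n) ω) *
        stopDiffValue X X' c n k ω ^ 2 ∂Literature.Probability.Process.preWienerMeasure ≤
      4 + 4 * η' / ε + 16 * c / ε * (Literature.Probability.Process.preWienerMeasure {ω | ∃ s ≤ T,
        η' ≤ |sampleDiffIntegral hX hX' n s ω - (X s ω - X' s ω)|}).toReal := by
  haveI := Literature.Probability.RandomPlanarGeometry.isProbabilityMeasure_preWienerMeasure'
  set A : Set (ℝ≥0 → ℝ) := {ω | ∃ s ≤ T,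
    η' ≤ |sampleDiffIntegral hX hX' n s ω - (X s ω - X' s ω)|} with hA
  set A' := toMeasurable Literature.Probability.Process.preWienerMeasure A with hA'
  have hA'm : MeasurableSet A' := measurableSet_toMeasurable _ _
  have hAA' : A ⊆ A' := subset_toMeasurable _ _
  set g : (ℝ≥0 → ℝ) → ℝ := fun ω ↦
    ywF'' ε ((stopDiff X X' c n hX hX').integral Literature.Probability.Process.brownian ((k : ℝ≥0) / 2 ^ n) ω) *
      stopDiffValue X X' c n k ω ^ 2 with hg
  -- pointwise bound
  have hpt : ∀ ω, g ω ≤ (4 + 4 * η' / ε) + 16 * c / ε * A'.indicator 1 ω := by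
    intro ω
    obtain ⟨h1, h2⟩ := ywF''_mul_stopDiffValue_sq_le hX hX' hc hε hcn k ω
    by_cases hω : ω ∈ A'
    · rw [Set.indicator_of_mem hω, Pi.one_apply, mul_one]
      have : 0 ≤ 4 + 4 * η' / ε := by positivity
      simp only [hg]
      linarith
    · rw [Set.indicator_of_notMem hω, mul_zero, add_zero]
      have hωA : ω ∉ A := fun h ↦ hω (hAA' h)
      have hm : |(X ((k : ℝ≥0) / 2 ^ n) ω - X' ((k : ℝ≥0) / 2 ^ n) ω) -
          sampleDiffIntegral hX hX' n ((k : ℝ≥0) / 2 ^ n) ω| < η' := by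
        by_contra hcon
        push Not at hcon
        refine hωA ⟨(k : ℝ≥0) / 2 ^ n, hk, ?_⟩
        rwa [abs_sub_comm]
      simp only [hg]
      have h4 : 4 * |(X ((k : ℝ≥0) / 2 ^ n) ω - X' ((k : ℝ≥0) / 2 ^ n) ω) -
          sampleDiffIntegral hX hX' n ((k : ℝ≥0) / 2 ^ n) ω| / ε ≤ 4 * η' / ε := by
        gcongr
      linarith
  -- integrability
  have hgm : Measurable g := ((continuous_ywF'' hε).measurable.comp
    (measurable_integral_stopDiff hX hX' c n _)).mul ((measurable_stopDiffValue hX hX' c n k).pow_const 2)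
  have hg0 : ∀ ω, 0 ≤ g ω := fun ω ↦
    mul_nonneg (ywF''_pos hε _).le (sq_nonneg _)
  have hgb : ∀ ω, g ω ≤ 16 * c / ε := fun ω ↦ (ywF''_mul_stopDiffValue_sq_le hX hX' hc hε hcn k ω).2
  have hgi : Integrable g Literature.Probability.Process.preWienerMeasure := by
    refine (integrable_const (16 * c / ε)).mono' hgm.aestronglyMeasurable (ae_of_all _ fun ω ↦ ?_)
    rw [Real.norm_eq_abs, abs_of_nonneg (hg0 ω)]
    exact hgb ω
  have hind : Integrable (A'.indicator (1 : (ℝ≥0 → ℝ) → ℝ)) Literature.Probability.Process.preWienerMeasure :=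
    (integrable_const (1 : ℝ)).indicator hA'm
  have hri : Integrable (fun ω ↦ (4 + 4 * η' / ε) + 16 * c / ε * A'.indicator 1 ω)
      Literature.Probability.Process.preWienerMeasure :=
    (integrable_const _).add (hind.const_mul _)
  calc ∫ ω, g ω ∂Literature.Probability.Process.preWienerMeasure
      ≤ ∫ ω, ((4 + 4 * η' / ε) + 16 * c / ε * A'.indicator 1 ω) ∂Literature.Probability.Process.preWienerMeasure :=
        integral_mono hgi hri hpt
    _ = (4 + 4 * η' / ε) + 16 * c / ε * (Literature.Probability.Process.preWienerMeasure A').toReal := by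
        rw [integral_add (integrable_const _) (hind.const_mul _), integral_const_mul,
          integral_indicator_one hA'm]
        simp [Measure.real]
    _ = _ := by rw [hA', measure_toMeasurable]

/-- The error constant of the Itô–Taylor estimate for `F_ε` and the stopped difference:
`6 ε⁻¹ (η ε²)⁻² · 256 c²`. [folklore] -/
def ywErrConst (c ε η : ℝ) : ℝ := 6 * ε⁻¹ / (η * ε ^ 2) ^ 2 * (256 * c ^ 2)

/-- **The Yamada–Watanabe expectation bound along the stopped elementary approximants**:
for `0 ≤ c`, `2√c ≤ n`, `ε, η, η' > 0` and any `T`,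
`E[F_ε(Xₙ(T))] ≤ 2T + 2Tη'/ε + (8cT/ε) P(sup_{s≤T} |Yₙ - D| ≥ η') + (16cη + K 2⁻ⁿ) T`.
Yamada–Watanabe (1971), proof of Thm 1 (`E[φₙ(X¹_t - X²_t)] ≤ t/n`), in expectation form along
elementary approximants via `SimpleProcess.ito_taylor_estimate_brownian`; hypotheses as in
Revuz–Yor (1999), Ch. IX, Thm (3.5)(ii). [folklore] -/
theorem integral_ywF_integral_stopDiff_le (hX : Adapted Literature.Probability.RandomPlanarGeometry.brownianFiltration X)
    (hX' : Adapted Literature.Probability.RandomPlanarGeometry.brownianFiltration X') {c ε η η' : ℝ} (hc : 0 ≤ c) (hε : 0 < ε) (hη : 0 < η)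
    (hη' : 0 < η') {n : ℕ} (hcn : 2 * Real.sqrt c ≤ n) (T : ℝ≥0) :
    ∫ ω, ywF ε ((stopDiff X X' c n hX hX').integral Literature.Probability.Process.brownian T ω) ∂Literature.Probability.Process.preWienerMeasure ≤
      2 * T + 2 * T * η' / ε + 8 * c * T / ε * (Literature.Probability.Process.preWienerMeasure {ω | ∃ s ≤ T,
        η' ≤ |sampleDiffIntegral hX hX' n s ω - (X s ω - X' s ω)|}).toReal +
      (16 * c * η + ywErrConst c ε η * (1 / 2 ^ n)) * T := by
  haveI := Literature.Probability.RandomPlanarGeometry.isProbabilityMeasure_preWienerMeasure'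
  set L := stopDiff X X' c n hX hX' with hL
  set p := (Literature.Probability.Process.preWienerMeasure {ω | ∃ s ≤ T,
    η' ≤ |sampleDiffIntegral hX hX' n s ω - (X s ω - X' s ω)|}).toReal with hp
  have hp0 : 0 ≤ p := ENNReal.toReal_nonneg
  -- the Itô–Taylor estimate
  have hδ : 0 < η * ε ^ 2 := by positivity
  have hIT := L.ito_taylor_estimate_brownian (hasDerivAt_ywF hε) (hasDerivAt_ywF' hε)
    (abs_ywF''_le hε) hδ (fun x y h ↦ abs_ywF''_sub_le_of_le hε h) T
  rw [ywF_zero hε.le, sub_zero] at hIT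
  have hlen : L.times.length = n * 2 ^ n + 1 := by simp [hL]
  -- abbreviations for the capped increments
  set Δ : ℕ → ℝ := fun i ↦ ((min T (L.time (i + 1)) : ℝ≥0) : ℝ) - (min T (L.time i) : ℝ≥0) with hΔ
  have hΔ0 : ∀ i ∈ range (L.times.length - 1), 0 ≤ Δ i := fun i hi ↦
    L.sub_min_time_nonneg T (by have := mem_range.1 hi; omega)
  have hΔle : ∀ i ∈ range (L.times.length - 1), Δ i ≤ 1 / 2 ^ n := by
    intro i hi
    have hi' : i + 1 < L.times.length := by have := mem_range.1 hi; omega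
    refine (L.sub_min_time_le T hi').trans ?_
    rw [L.time_of_times_eq_dyadicTimes rfl (by omega), L.time_of_times_eq_dyadicTimes rfl (by omega)]
    rw [NNReal.coe_div, NNReal.coe_div]
    push_cast
    rw [← sub_div]
    ring_nf
    rfl
  have hΔsum : ∑ i ∈ range (L.times.length - 1), Δ i ≤ T := L.sum_sub_min_time_le T
  -- the main (Riemann) term
  set bnd : ℝ := 4 + 4 * η' / ε + 16 * c / ε * p with hbnd
  have hbnd0 : 0 ≤ bnd := by positivity
  have hmain : ∀ i ∈ range (L.times.length - 1),
      Δ i * ∫ ω, ywF'' ε (L.integral Literature.Probability.Process.brownian (min T (L.time i)) ω) * L.value i ω ^ 2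
        ∂Literature.Probability.Process.preWienerMeasure ≤ Δ i * bnd := by
    intro i hi
    have hi' : i + 1 < L.times.length := by have := mem_range.1 hi; omega
    by_cases hTi : L.time i ≤ T
    · rw [min_eq_right hTi]
      refine mul_le_mul_of_nonneg_left ?_ (hΔ0 i hi)
      have hti : L.time i = (i : ℝ≥0) / 2 ^ n := L.time_of_times_eq_dyadicTimes rfl (by omega)
      rw [hti] at hTi ⊢
      exact integral_ywF''_mul_stopDiffValue_sq_le hX hX' hc hε hη' hcn hTi
    · push Not at hTi
      have : Δ i = 0 := by
        simp only [hΔ]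
        rw [min_eq_left hTi.le, min_eq_left (hTi.le.trans (L.time_mono (Nat.le_succ i) hi')), sub_self]
      rw [this, zero_mul, zero_mul]
  have hmain' : ∑ i ∈ range (L.times.length - 1),
      Δ i * ∫ ω, ywF'' ε (L.integral Literature.Probability.Process.brownian (min T (L.time i)) ω) * L.value i ω ^ 2
        ∂Literature.Probability.Process.preWienerMeasure ≤ T * bnd :=
    calc _ ≤ ∑ i ∈ range (L.times.length - 1), Δ i * bnd := sum_le_sum hmain
      _ = (∑ i ∈ range (L.times.length - 1), Δ i) * bnd := by rw [sum_mul]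
      _ ≤ T * bnd := mul_le_mul_of_nonneg_right hΔsum hbnd0
  -- the error term
  have herr : ∑ i ∈ range (L.times.length - 1),
      (η * Δ i * (∫ ω, L.value i ω ^ 2 ∂Literature.Probability.Process.preWienerMeasure) +
        6 * ε⁻¹ / (η * ε ^ 2) ^ 2 * Δ i ^ 2 * ∫ ω, L.value i ω ^ 4 ∂Literature.Probability.Process.preWienerMeasure) ≤
      (16 * c * η + ywErrConst c ε η * (1 / 2 ^ n)) * T := by
    have hterm : ∀ i ∈ range (L.times.length - 1),
        η * Δ i * (∫ ω, L.value i ω ^ 2 ∂Literature.Probability.Process.preWienerMeasure) +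
          6 * ε⁻¹ / (η * ε ^ 2) ^ 2 * Δ i ^ 2 * ∫ ω, L.value i ω ^ 4 ∂Literature.Probability.Process.preWienerMeasure ≤
        (16 * c * η + ywErrConst c ε η * (1 / 2 ^ n)) * Δ i := by
      intro i hi
      have h2 : ∫ ω, L.value i ω ^ 2 ∂Literature.Probability.Process.preWienerMeasure ≤ 16 * c :=
        integral_stopDiffValue_sq_le (X := X) (X' := X') hc n i
      have h4 : ∫ ω, L.value i ω ^ 4 ∂Literature.Probability.Process.preWienerMeasure ≤ 256 * c ^ 2 :=
        integral_stopDiffValue_pow_four_le (X := X) (X' := X') hc n i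
      have h4' : 0 ≤ ∫ ω, L.value i ω ^ 4 ∂Literature.Probability.Process.preWienerMeasure :=
        integral_nonneg fun ω ↦ by positivity
      have hd := hΔ0 i hi
      have hdl := hΔle i hi
      have hK : 0 ≤ 6 * ε⁻¹ / (η * ε ^ 2) ^ 2 := by positivity
      have e1 : η * Δ i * (∫ ω, L.value i ω ^ 2 ∂Literature.Probability.Process.preWienerMeasure) ≤ 16 * c * η * Δ i := by
        calc _ ≤ η * Δ i * (16 * c) := mul_le_mul_of_nonneg_left h2 (by positivity)
          _ = _ := by ring
      have e2 : 6 * ε⁻¹ / (η * ε ^ 2) ^ 2 * Δ i ^ 2 * ∫ ω, L.value i ω ^ 4 ∂Literature.Probability.Process.preWienerMeasure ≤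
          ywErrConst c ε η * (1 / 2 ^ n) * Δ i := by
        have hΔ2 : Δ i ^ 2 ≤ Δ i * (1 / 2 ^ n) := by
          rw [sq]; exact mul_le_mul_of_nonneg_left hdl hd
        calc _ ≤ 6 * ε⁻¹ / (η * ε ^ 2) ^ 2 * (Δ i * (1 / 2 ^ n)) * (256 * c ^ 2) :=
              mul_le_mul (mul_le_mul_of_nonneg_left hΔ2 hK) h4 h4'
                (mul_nonneg hK (mul_nonneg hd (by positivity)))
          _ = _ := by simp only [ywErrConst]; ring
      linarith
    calc _ ≤ ∑ i ∈ range (L.times.length - 1),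
          (16 * c * η + ywErrConst c ε η * (1 / 2 ^ n)) * Δ i := sum_le_sum hterm
      _ = (16 * c * η + ywErrConst c ε η * (1 / 2 ^ n)) *
            ∑ i ∈ range (L.times.length - 1), Δ i := by rw [mul_sum]
      _ ≤ _ := by
          refine mul_le_mul_of_nonneg_left hΔsum ?_
          have : 0 ≤ ywErrConst c ε η := by simp only [ywErrConst]; positivity
          positivity
  -- combine
  have habs := (abs_sub_le_iff.1 (hIT.trans herr)).1
  have : ∫ ω, ywF ε (L.integral Literature.Probability.Process.brownian T ω) ∂Literature.Probability.Process.preWienerMeasure ≤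
      2⁻¹ * (T * bnd) + (16 * c * η + ywErrConst c ε η * (1 / 2 ^ n)) * T := by
    nlinarith [hmain', habs]
  calc _ ≤ 2⁻¹ * (T * bnd) + (16 * c * η + ywErrConst c ε η * (1 / 2 ^ n)) * T := this
    _ = _ := by simp only [hbnd]; ring

/-! #### Markov's inequality and the event inclusions -/

/-- `F_ε(Xₙ(T))` is integrable (quadratic growth, `Xₙ(T) ∈ L²`). [folklore] -/
theorem integrable_ywF_integral_stopDiff (hX : Adapted Literature.Probability.RandomPlanarGeometry.brownianFiltration X)
    (hX' : Adapted Literature.Probability.RandomPlanarGeometry.brownianFiltration X') (c : ℝ) {ε : ℝ} (hε : 0 < ε) (n : ℕ) (T : ℝ≥0) :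
    Integrable (fun ω ↦ ywF ε ((stopDiff X X' c n hX hX').integral Literature.Probability.Process.brownian T ω))
      Literature.Probability.Process.preWienerMeasure :=
  haveI := Literature.Probability.RandomPlanarGeometry.isProbabilityMeasure_preWienerMeasure'
  Literature.Probability.Process.integrable_comp_of_abs_deriv_two_le (hasDerivAt_ywF hε) (hasDerivAt_ywF' hε) (abs_ywF''_le hε)
    (Literature.Probability.Process.memLp_two_integral_brownian _ T)

/-- The bad event: some nonnegative rational time `q < T` at which `|X_q| + |X'_q| > c`
(a measurable, `n`-independent superset of "some dyadic grid point before `T` is bad").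
[folklore] -/
def badBefore (X X' : ℝ≥0 → (ℝ≥0 → ℝ) → ℝ) (c : ℝ) (T : ℝ≥0) : Set (ℝ≥0 → ℝ) :=
  {ω | ∃ q : ℚ, ((q : ℝ).toNNReal < T) ∧ c < |X ((q : ℝ).toNNReal) ω| + |X' ((q : ℝ).toNNReal) ω|}

/-- The bad event is measurable. [folklore] -/
theorem measurableSet_badBefore (hX : Adapted Literature.Probability.RandomPlanarGeometry.brownianFiltration X)
    (hX' : Adapted Literature.Probability.RandomPlanarGeometry.brownianFiltration X') (c : ℝ) (T : ℝ≥0) :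
    MeasurableSet (badBefore X X' c T) := by
  have : badBefore X X' c T = ⋃ q : ℚ, {ω | ((q : ℝ).toNNReal < T) ∧
      c < |X ((q : ℝ).toNNReal) ω| + |X' ((q : ℝ).toNNReal) ω|} := by
    ext ω; simp [badBefore]
  rw [this]
  refine MeasurableSet.iUnion fun q ↦ ?_
  by_cases hq : (q : ℝ).toNNReal < T
  · simp only [hq, true_and]
    exact measurableSet_lt measurable_const
      ((((hX _).mono (Literature.Probability.RandomPlanarGeometry.brownianFiltration.le _) le_rfl).abs).add
        (((hX' _).mono (Literature.Probability.RandomPlanarGeometry.brownianFiltration.le _) le_rfl).abs))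
  · simp only [hq, false_and, Set.setOf_false, MeasurableSet.empty]

/-- Dyadic grid points are nonnegative rationals: `((j/2ⁿ : ℚ) : ℝ)⁺ = j/2ⁿ`. [folklore] -/
theorem toNNReal_ratCast_natDiv (j n : ℕ) :
    (((j : ℚ) / 2 ^ n : ℚ) : ℝ).toNNReal = (j : ℝ≥0) / 2 ^ n := by
  apply NNReal.eq
  rw [Real.coe_toNNReal _ (by push_cast; positivity)]
  push_cast
  simp

/-- If some dyadic grid point `i/2ⁿ < T` is not good, the bad event occurs. [folklore] -/
theorem badBefore_of_not_goodUpTo {c : ℝ} {n : ℕ} {T : ℝ≥0} {ω : ℝ≥0 → ℝ} {i : ℕ}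
    (hi : (i : ℝ≥0) / 2 ^ n < T) (h : ¬ GoodUpTo X X' c n i ω) : ω ∈ badBefore X X' c T := by
  simp only [GoodUpTo, not_forall, not_le, exists_prop] at h
  obtain ⟨j, hji, hj⟩ := h
  refine ⟨(j : ℚ) / 2 ^ n, ?_, ?_⟩
  · rw [toNNReal_ratCast_natDiv]
    refine lt_of_le_of_lt ?_ hi
    exact div_le_div_of_nonneg_right (by exact_mod_cast hji) (pow_pos two_pos n).le
  · rw [toNNReal_ratCast_natDiv]
    exact hj

/-- **The event inclusion**: with `2√c ≤ n`,
`{|D_T| ≥ 2r} ⊆ {|Xₙ(T)| ≥ r} ∪ badBefore ∪ {|Yₙ(T) - D_T| ≥ r}` (on the complement of the last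
two events `Xₙ(T) = Yₙ(T)`). [folklore] -/
theorem setOf_le_abs_sub_subset (hX : Adapted Literature.Probability.RandomPlanarGeometry.brownianFiltration X)
    (hX' : Adapted Literature.Probability.RandomPlanarGeometry.brownianFiltration X') {c : ℝ} {n : ℕ} (hcn : 2 * Real.sqrt c ≤ n) (r : ℝ)
    (T : ℝ≥0) :
    {ω | 2 * r ≤ |X T ω - X' T ω|} ⊆
      {ω | r ≤ |(stopDiff X X' c n hX hX').integral Literature.Probability.Process.brownian T ω|} ∪ badBefore X X' c T ∪
        {ω | r ≤ |sampleDiffIntegral hX hX' n T ω - (X T ω - X' T ω)|} := by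
  intro ω hω
  by_contra hcon
  simp only [Set.mem_union, Set.mem_setOf_eq, not_or, not_le] at hcon
  obtain ⟨⟨h1, h2⟩, h3⟩ := hcon
  have hgood : ∀ i : ℕ, ((i : ℝ≥0) / 2 ^ n) < T → GoodUpTo X X' c n i ω := fun i hi ↦ by
    by_contra hg
    exact h2 (badBefore_of_not_goodUpTo hi hg)
  have heq : (stopDiff X X' c n hX hX').integral Literature.Probability.Process.brownian T ω = sampleDiffIntegral hX hX' n T ω :=
    integral_stopDiff_eq X X' c n hX hX' hcn hgood Literature.Probability.Process.brownian
  rw [heq] at h1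
  rw [abs_sub_comm] at h3
  have hω' : 2 * r ≤ |X T ω - X' T ω| := hω
  have := abs_sub_abs_le_abs_sub (X T ω - X' T ω) (sampleDiffIntegral hX hX' n T ω)
  linarith

/-- **Markov's inequality for the Yamada–Watanabe functional**: for `r ≥ 0` with
`F_ε(r) > 0`, `P(|Xₙ(T)| ≥ r) ≤ E[F_ε(Xₙ(T))] / F_ε(r)`. [folklore] -/
theorem measure_le_abs_integral_stopDiff_le (hX : Adapted Literature.Probability.RandomPlanarGeometry.brownianFiltration X)
    (hX' : Adapted Literature.Probability.RandomPlanarGeometry.brownianFiltration X') (c : ℝ) {ε : ℝ} (hε : 0 < ε) (n : ℕ) (T : ℝ≥0)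
    {r : ℝ} (hr : 0 ≤ r) (hFr : 0 < ywF ε r) :
    Literature.Probability.Process.preWienerMeasure {ω | r ≤ |(stopDiff X X' c n hX hX').integral Literature.Probability.Process.brownian T ω|} ≤
      ENNReal.ofReal ((∫ ω, ywF ε ((stopDiff X X' c n hX hX').integral Literature.Probability.Process.brownian T ω)
        ∂Literature.Probability.Process.preWienerMeasure) / ywF ε r) := by
  haveI := Literature.Probability.RandomPlanarGeometry.isProbabilityMeasure_preWienerMeasure'
  set V := fun ω ↦ (stopDiff X X' c n hX hX').integral Literature.Probability.Process.brownian T ω with hV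
  have hsub : {ω | r ≤ |V ω|} ⊆ {ω | ywF ε r ≤ ywF ε (V ω)} := fun ω hω ↦
    ywF_le_ywF_of_le_abs hε hr hω
  have hmk := mul_meas_ge_le_integral_of_nonneg (μ := Literature.Probability.Process.preWienerMeasure)
    (ae_of_all _ fun ω ↦ ywF_nonneg hε (V ω)) (integrable_ywF_integral_stopDiff hX hX' c hε n T)
    (ywF ε r)
  have hreal : Literature.Probability.Process.preWienerMeasure.real {ω | ywF ε r ≤ ywF ε (V ω)} ≤
      (∫ ω, ywF ε (V ω) ∂Literature.Probability.Process.preWienerMeasure) / ywF ε r := by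
    rw [le_div_iff₀ hFr, mul_comm]
    exact hmk
  calc Literature.Probability.Process.preWienerMeasure {ω | r ≤ |V ω|} ≤ Literature.Probability.Process.preWienerMeasure {ω | ywF ε r ≤ ywF ε (V ω)} :=
        measure_mono hsub
    _ = ENNReal.ofReal (Literature.Probability.Process.preWienerMeasure.real {ω | ywF ε r ≤ ywF ε (V ω)}) :=
        (ENNReal.ofReal_toReal (measure_ne_top _ _)).symm
    _ ≤ _ := ENNReal.ofReal_le_ofReal hreal

/-! #### Passage to the limit `n → ∞`, then `ε, η → 0` -/

/-- **The one-time estimate**: if `Yₙ → D = X - X'` u.c.p., then for `T`, `r > 0`, `c ≥ 0`: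
`P(|D_T| ≥ 2r) ≤ P(badBefore c T)`.
Revuz–Yor, *Continuous Martingales and Brownian Motion* (1999), Ch. IX, proof of Thm (3.5)(ii)
(`E|Y¹_t - Y²_t| = 0` for the stopped solutions); Yamada–Watanabe (1971), proof of Thm 1
(`P(|X¹_t - X²_t| > 0) = 0` from `E[φₙ] ≤ t/n` and `φₙ ↑ |x|`). [folklore] -/
theorem measure_le_abs_sub_le_badBefore (hX : Adapted Literature.Probability.RandomPlanarGeometry.brownianFiltration X)
    (hX' : Adapted Literature.Probability.RandomPlanarGeometry.brownianFiltration X')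
    (hucp : Literature.Probability.Process.TendstoUCP (fun n ↦ sampleDiffIntegral hX hX' n) (fun t ω ↦ X t ω - X' t ω)
      Literature.Probability.Process.preWienerMeasure)
    (T : ℝ≥0) {r : ℝ} (hr : 0 < r) {c : ℝ} (hc : 0 ≤ c) :
    Literature.Probability.Process.preWienerMeasure {ω | 2 * r ≤ |X T ω - X' T ω|} ≤ Literature.Probability.Process.preWienerMeasure (badBefore X X' c T) := by
  haveI := Literature.Probability.RandomPlanarGeometry.isProbabilityMeasure_preWienerMeasure'
  set S := Literature.Probability.Process.preWienerMeasure {ω | 2 * r ≤ |X T ω - X' T ω|} with hS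
  set b := Literature.Probability.Process.preWienerMeasure (badBefore X X' c T) with hb
  -- Step 1: for fixed `ε, η, η'`, let `n → ∞`
  have step1 : ∀ {ε η η' : ℝ}, 0 < ε → 0 < η → 0 < η' → 0 < ywF ε r →
      S ≤ ENNReal.ofReal ((2 * (T : ℝ) + 2 * T * η' / ε + (16 * c * η) * T) / ywF ε r) + b := by
    intro ε η η' hε hη hη' hFr
    -- the three vanishing sequences
    have hA := hucp T η' hη'
    have hC := hucp T r hr
    have h2n : Tendsto (fun n : ℕ ↦ (1 : ℝ) / 2 ^ n) atTop (𝓝 0) := by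
      exact tendsto_const_nhds.div_atTop
        (tendsto_pow_atTop_atTop_of_one_lt (one_lt_two : (1 : ℝ) < 2))
    -- the bound for each large `n`
    set u : ℕ → ℝ≥0∞ := fun n ↦ ENNReal.ofReal ((2 * (T : ℝ) + 2 * T * η' / ε +
        8 * c * T / ε * (Literature.Probability.Process.preWienerMeasure {ω | ∃ s ≤ T,
          η' ≤ |sampleDiffIntegral hX hX' n s ω - (X s ω - X' s ω)|}).toReal +
        (16 * c * η + ywErrConst c ε η * (1 / 2 ^ n)) * T) / ywF ε r) + b +
      Literature.Probability.Process.preWienerMeasure {ω | ∃ s ≤ T, r ≤ |sampleDiffIntegral hX hX' n s ω - (X s ω - X' s ω)|}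
      with hu
    have hev : ∀ᶠ n in atTop, S ≤ u n := by
      refine (eventually_ge_atTop ⌈2 * Real.sqrt c⌉₊).mono fun n hn ↦ ?_
      have hcn : 2 * Real.sqrt c ≤ n := (Nat.le_ceil _).trans (by exact_mod_cast hn)
      calc S ≤ Literature.Probability.Process.preWienerMeasure ({ω | r ≤ |(stopDiff X X' c n hX hX').integral Literature.Probability.Process.brownian T ω|} ∪
            badBefore X X' c T ∪
            {ω | r ≤ |sampleDiffIntegral hX hX' n T ω - (X T ω - X' T ω)|}) :=
            measure_mono (setOf_le_abs_sub_subset hX hX' hcn r T)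
        _ ≤ Literature.Probability.Process.preWienerMeasure {ω | r ≤ |(stopDiff X X' c n hX hX').integral Literature.Probability.Process.brownian T ω|} + b +
            Literature.Probability.Process.preWienerMeasure {ω | r ≤ |sampleDiffIntegral hX hX' n T ω - (X T ω - X' T ω)|} :=
            (measure_union_le _ _).trans (add_le_add (measure_union_le _ _) le_rfl)
        _ ≤ u n := by
            refine add_le_add (add_le_add ?_ le_rfl) (measure_mono fun ω hω ↦ ⟨T, le_rfl, hω⟩)
            refine (measure_le_abs_integral_stopDiff_le hX hX' c hε n T hr.le hFr).trans ?_
            exact ENNReal.ofReal_le_ofReal (div_le_div_of_nonneg_right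
              (integral_ywF_integral_stopDiff_le hX hX' hc hε hη hη' hcn T) hFr.le)
    -- the limit of `u`
    have hlim : Tendsto u atTop (𝓝 (ENNReal.ofReal ((2 * (T : ℝ) + 2 * T * η' / ε +
        (16 * c * η) * T) / ywF ε r) + b + 0)) := by
      refine Tendsto.add (Tendsto.add ?_ tendsto_const_nhds) hC
      refine ENNReal.tendsto_ofReal (Tendsto.div_const ?_ _)
      have hp : Tendsto (fun n ↦ (Literature.Probability.Process.preWienerMeasure {ω | ∃ s ≤ T,
          η' ≤ |sampleDiffIntegral hX hX' n s ω - (X s ω - X' s ω)|}).toReal) atTop (𝓝 0) := by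
        have := (ENNReal.tendsto_toReal ENNReal.zero_ne_top).comp hA
        rw [ENNReal.toReal_zero] at this
        exact this
      have h1 : Tendsto (fun n ↦ 2 * (T : ℝ) + 2 * T * η' / ε + 8 * c * T / ε *
          (Literature.Probability.Process.preWienerMeasure {ω | ∃ s ≤ T,
            η' ≤ |sampleDiffIntegral hX hX' n s ω - (X s ω - X' s ω)|}).toReal) atTop
          (𝓝 (2 * T + 2 * T * η' / ε + 8 * c * T / ε * 0)) :=
        tendsto_const_nhds.add (hp.const_mul _)
      have h2 : Tendsto (fun n : ℕ ↦ (16 * c * η + ywErrConst c ε η * (1 / 2 ^ n)) * (T : ℝ))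
          atTop (𝓝 ((16 * c * η + ywErrConst c ε η * 0) * T)) :=
        (tendsto_const_nhds.add (h2n.const_mul _)).mul_const _
      have := h1.add h2
      simp only [mul_zero, add_zero] at this
      exact this
    rw [add_zero] at hlim
    exact ge_of_tendsto hlim hev
  -- Step 2: `ε = r / sinh (k + 2)`, `η' = ε/(k+1)`, `η = 1/(k+1)`, `k → ∞`
  have step2 : ∀ k : ℕ, S ≤ ENNReal.ofReal ((4 * (T : ℝ) + 16 * c * T) / (r * (k + 1))) + b := by
    intro k
    have hk1 : (0 : ℝ) < k + 1 := by positivity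
    set Lk : ℝ := k + 2 with hLk
    have hL : 0 < Lk := by positivity
    set ε : ℝ := r / Real.sinh Lk with hεd
    have hε : 0 < ε := div_pos hr (Real.sinh_pos_iff.2 hL)
    have hFr : r * (k + 1) ≤ ywF ε r := by
      have := mul_sub_one_le_ywF_div_sinh hr hL
      simp only [hLk] at this
      convert this using 2
      ring
    have hFr0 : 0 < ywF ε r := lt_of_lt_of_le (by positivity) hFr
    have h := step1 hε (η := 1 / (k + 1)) (η' := ε / (k + 1)) (by positivity) (by positivity) hFr0
    refine h.trans (add_le_add (ENNReal.ofReal_le_ofReal ?_) le_rfl)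
    have hnum : 2 * (T : ℝ) + 2 * T * (ε / (k + 1)) / ε + 16 * c * (1 / (k + 1)) * T ≤
        4 * T + 16 * c * T := by
      have e1 : 2 * (T : ℝ) * (ε / (k + 1)) / ε = 2 * T / (k + 1) := by
        field_simp
      rw [e1]
      have hT : (0 : ℝ) ≤ T := T.coe_nonneg
      have h1 : 2 * (T : ℝ) / (k + 1) ≤ 2 * T := div_le_self (by positivity) (by linarith)
      have h2 : 16 * c * (1 / ((k : ℝ) + 1)) * T ≤ 16 * c * T := by
        have : 1 / ((k : ℝ) + 1) ≤ 1 := by rw [div_le_one hk1]; linarith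
        calc 16 * c * (1 / ((k : ℝ) + 1)) * T ≤ 16 * c * 1 * T := by gcongr
          _ = 16 * c * T := by ring
      linarith
    calc _ ≤ (4 * (T : ℝ) + 16 * c * T) / ywF ε r := div_le_div_of_nonneg_right hnum hFr0.le
      _ ≤ (4 * T + 16 * c * T) / (r * (k + 1)) :=
          div_le_div_of_nonneg_left (by positivity) (by positivity) hFr
  -- Step 3: `k → ∞`
  have hlim : Tendsto (fun k : ℕ ↦ ENNReal.ofReal ((4 * (T : ℝ) + 16 * c * T) / (r * (k + 1))) + b)
      atTop (𝓝 (0 + b)) := by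
    refine Tendsto.add ?_ tendsto_const_nhds
    rw [← ENNReal.ofReal_zero]
    refine ENNReal.tendsto_ofReal ?_
    have h1 : Tendsto (fun k : ℕ ↦ r * ((k : ℝ) + 1)) atTop atTop :=
      (tendsto_atTop_add_const_right _ 1 tendsto_natCast_atTop_atTop).const_mul_atTop hr
    exact tendsto_const_nhds.div_atTop h1
  rw [zero_add] at hlim
  exact ge_of_tendsto hlim (Eventually.of_forall step2)

/-! #### The limit `c → ∞` along a.s. continuous paths -/

/-- Along a.s. continuous paths the bad events `badBefore c T` have probability `→ 0` as
`c → ∞`. [folklore] -/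
theorem tendsto_measure_badBefore (hX : Adapted Literature.Probability.RandomPlanarGeometry.brownianFiltration X)
    (hX' : Adapted Literature.Probability.RandomPlanarGeometry.brownianFiltration X') (hXc : ∀ᵐ ω ∂Literature.Probability.Process.preWienerMeasure, Continuous (X · ω))
    (hX'c : ∀ᵐ ω ∂Literature.Probability.Process.preWienerMeasure, Continuous (X' · ω)) (T : ℝ≥0) :
    Tendsto (fun c : ℕ ↦ Literature.Probability.Process.preWienerMeasure (badBefore X X' c T)) atTop (𝓝 0) := by
  haveI := Literature.Probability.RandomPlanarGeometry.isProbabilityMeasure_preWienerMeasure'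
  refine Literature.Probability.Process.tendsto_measure_of_ae_eventually_notMem
    (fun c ↦ measurableSet_badBefore hX hX' c T) ?_
  filter_upwards [hXc, hX'c] with ω hω hω'
  -- the continuous path `|X| + |X'|` is bounded on `[0, T]`
  have hcont : Continuous fun t ↦ |X t ω| + |X' t ω| := (hω.abs).add (hω'.abs)
  obtain ⟨M, hM⟩ := isCompact_Icc.exists_bound_of_continuousOn (s := Set.Icc (0 : ℝ≥0) T)
    hcont.continuousOn
  refine (eventually_ge_atTop ⌈M⌉₊).mono fun c hc hmem ↦ ?_
  obtain ⟨q, hq, hbad⟩ := hmem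
  have hqT : (q : ℝ).toNNReal ∈ Set.Icc (0 : ℝ≥0) T := ⟨zero_le, hq.le⟩
  have h1 := hM _ hqT
  rw [Real.norm_eq_abs, abs_of_nonneg (by positivity)] at h1
  have : (M : ℝ) ≤ c := (Nat.le_ceil M).trans (by exact_mod_cast hc)
  linarith

/-- **The core of pathwise uniqueness**: if `X, X'` are adapted with a.s. continuous paths
and the differences of the sample integrals `Yₙ` converge u.c.p. to `D = X - X'`, then for
every `T`, `D_T = 0` a.s.
Revuz–Yor, *Continuous Martingales and Brownian Motion* (1999), Ch. IX, Thm (3.5)(ii). [folklore] -/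
theorem ae_sub_eq_zero_of_tendstoUCP (hX : Adapted Literature.Probability.RandomPlanarGeometry.brownianFiltration X)
    (hX' : Adapted Literature.Probability.RandomPlanarGeometry.brownianFiltration X') (hXc : ∀ᵐ ω ∂Literature.Probability.Process.preWienerMeasure, Continuous (X · ω))
    (hX'c : ∀ᵐ ω ∂Literature.Probability.Process.preWienerMeasure, Continuous (X' · ω))
    (hucp : Literature.Probability.Process.TendstoUCP (fun n ↦ sampleDiffIntegral hX hX' n) (fun t ω ↦ X t ω - X' t ω)
      Literature.Probability.Process.preWienerMeasure) (T : ℝ≥0) :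
    ∀ᵐ ω ∂Literature.Probability.Process.preWienerMeasure, X T ω - X' T ω = 0 := by
  haveI := Literature.Probability.RandomPlanarGeometry.isProbabilityMeasure_preWienerMeasure'
  -- `P(|D_T| ≥ 2r) = 0` for every `r > 0`
  have key : ∀ r : ℝ, 0 < r → Literature.Probability.Process.preWienerMeasure {ω | 2 * r ≤ |X T ω - X' T ω|} = 0 := by
    intro r hr
    refine le_antisymm ?_ zero_le
    refine ge_of_tendsto (tendsto_measure_badBefore hX hX' hXc hX'c T)
      (Eventually.of_forall fun c ↦ ?_)
    exact measure_le_abs_sub_le_badBefore hX hX' hucp T hr (Nat.cast_nonneg c)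
  have hsub : {ω | ¬ X T ω - X' T ω = 0} ⊆ ⋃ k : ℕ, {ω | 2 * (1 / ((k : ℝ) + 1)) ≤ |X T ω - X' T ω|} := by
    intro ω hω
    simp only [Set.mem_setOf_eq] at hω
    have hpos : 0 < |X T ω - X' T ω| := abs_pos.2 hω
    obtain ⟨k, hk⟩ := exists_nat_one_div_lt (half_pos hpos)
    simp only [Set.mem_iUnion, Set.mem_setOf_eq]
    exact ⟨k, by linarith⟩
  rw [ae_iff]
  exact measure_mono_null hsub <| (measure_iUnion_null_iff).2 fun k ↦ key _ (by positivity)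

end Core

/-! ### Assembly: pathwise uniqueness for `BESQ^δ(z₀)` -/

section Assembly

/-- For a squared Bessel process `Z` (a solution of `dZ = δ dt + 2√|Z| dB`), the elementary
integrals of the dyadic samples of `σ(Ẑ)`, `Ẑ = dyadicReg Z` the progressive version, converge
u.c.p. to the Itô-integral part `J` of `Z`; moreover `Z` and `Ẑ` have a.s. continuous, a.s.
equal paths, and `Z = z₀ + δ t + J`. [folklore] -/
theorem IsSquaredBesselProcess.tendstoUCP_sample {δ z₀ : ℝ} {Z : ℝ≥0 → (ℝ≥0 → ℝ) → ℝ}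
    (hZ : IsSquaredBesselProcess δ z₀ Z Literature.Probability.Process.brownian Literature.Probability.RandomPlanarGeometry.brownianFiltration Literature.Probability.Process.preWienerMeasure) :
    ∃ J : ℝ≥0 → (ℝ≥0 → ℝ) → ℝ,
      (∀ᵐ ω ∂Literature.Probability.Process.preWienerMeasure, ∀ t, Z t ω = z₀ + (∫ _ in (0 : ℝ)..t, δ) + J t ω) ∧
      (∀ᵐ ω ∂Literature.Probability.Process.preWienerMeasure, Continuous (Z · ω)) ∧
      Literature.Probability.Process.TendstoUCP (fun n ↦ (Literature.Probability.Process.SimpleProcess.sample (fun t ω ↦ besqσ (dyadicReg Z t ω))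
        (adapted_besqσ_comp (dyadicReg Z) (adapted_dyadicReg hZ.adapted)) n).integral Literature.Probability.Process.brownian)
        J Literature.Probability.Process.preWienerMeasure := by
  obtain ⟨h0, hZa, hdrift, J, hJ, hZeq⟩ := hZ
  have hZc : ∀ᵐ ω ∂Literature.Probability.Process.preWienerMeasure, Continuous (Z · ω) :=
    IsStrongSolution.ae_continuous (show IsSquaredBesselProcess δ z₀ Z Literature.Probability.Process.brownian Literature.Probability.RandomPlanarGeometry.brownianFiltration
      Literature.Probability.Process.preWienerMeasure from ⟨h0, hZa, hdrift, J, hJ, hZeq⟩)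
  refine ⟨J, ?_, hZc, ?_⟩
  · filter_upwards [hZeq] with ω hω t
    rw [hω t, h0 ω]
  · -- the samples of `σ(Ẑ)` approximate `σ(Z)`
    set X := dyadicReg Z with hXd
    have hXa : Adapted Literature.Probability.RandomPlanarGeometry.brownianFiltration X := adapted_dyadicReg hZa
    have hXZ : ∀ᵐ ω ∂Literature.Probability.Process.preWienerMeasure, ∀ t, X t ω = Z t ω := by
      filter_upwards [hZc] with ω hω t
      exact dyadicReg_apply_of_continuous hω t
    have hσm : Measurable (Function.uncurry fun t ω ↦ besqσ (X t ω)) :=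
      continuous_besqσ.measurable.comp
        (IsStronglyProgressive.measurable_uncurry (isStronglyProgressive_dyadicReg hZa))
    have hσc : ∀ᵐ ω ∂Literature.Probability.Process.preWienerMeasure, Continuous fun t ↦ besqσ (X t ω) := by
      filter_upwards [hZc, hXZ] with ω hω hωX
      have : (fun t ↦ besqσ (X t ω)) = fun t ↦ besqσ (Z t ω) := funext fun t ↦ by rw [hωX t]
      rw [this]
      exact continuous_besqσ.comp hω
    have happ := Literature.Probability.Process.isApproxSeq_sample (adapted_besqσ_comp X hXa) hσm hσc
    have happ' : Literature.Probability.Process.SimpleProcess.IsApproxSeq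
        (fun n ↦ Literature.Probability.Process.SimpleProcess.sample (fun t ω ↦ besqσ (X t ω)) (adapted_besqσ_comp X hXa) n)
        (fun t ω ↦ 2 * Real.sqrt |Z t ω|) Literature.Probability.Process.preWienerMeasure := by
      refine (Literature.Probability.Process.SimpleProcess.isApproxSeq_congr_ae ?_).1 happ
      filter_upwards [hXZ] with ω hω t
      simp only [besqσ, hω t]
    exact hJ.2.2.2.2 _ happ'

/-- **Pathwise uniqueness for squared Bessel processes** (discharge of the named fact
`Literature.Analysis.FunctionSpaces.pathwiseUnique_squaredBessel`): two `BESQ^δ(z₀)` strong solutions driven by the canonical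
Brownian motion and adapted to its raw natural filtration are indistinguishable.
Revuz–Yor, *Continuous Martingales and Brownian Motion* (1999), Ch. XI, §1, p. 439
("for every `δ` and `x`, this equation has a unique strong solution") via Ch. IX, Thm (3.5)(ii)
(Yamada–Watanabe), proved here in expectation form along elementary approximants.
[cite: RevuzYor1999, Ch. XI §1 and Ch. IX Thm (3.5)(ii)] -/
theorem pathwiseUnique_squaredBessel_holds : pathwiseUnique_squaredBessel := by
  intro δ z₀ Z Z' hZ hZ'
  haveI := Literature.Probability.RandomPlanarGeometry.isProbabilityMeasure_preWienerMeasure'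
  obtain ⟨J, hZeq, hZc, hJucp⟩ := hZ.tendstoUCP_sample
  obtain ⟨J', hZ'eq, hZ'c, hJ'ucp⟩ := hZ'.tendstoUCP_sample
  set X := dyadicReg Z with hXd
  set X' := dyadicReg Z' with hX'd
  have hXa : Adapted Literature.Probability.RandomPlanarGeometry.brownianFiltration X := adapted_dyadicReg hZ.adapted
  have hX'a : Adapted Literature.Probability.RandomPlanarGeometry.brownianFiltration X' := adapted_dyadicReg hZ'.adapted
  have hXZ : ∀ᵐ ω ∂Literature.Probability.Process.preWienerMeasure, ∀ t, X t ω = Z t ω := by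
    filter_upwards [hZc] with ω hω t
    exact dyadicReg_apply_of_continuous hω t
  have hX'Z' : ∀ᵐ ω ∂Literature.Probability.Process.preWienerMeasure, ∀ t, X' t ω = Z' t ω := by
    filter_upwards [hZ'c] with ω hω t
    exact dyadicReg_apply_of_continuous hω t
  have hXc : ∀ᵐ ω ∂Literature.Probability.Process.preWienerMeasure, Continuous (X · ω) := by
    filter_upwards [hZc, hXZ] with ω hω hωX
    have : (X · ω) = (Z · ω) := funext hωX
    rw [this]; exact hω
  have hX'c : ∀ᵐ ω ∂Literature.Probability.Process.preWienerMeasure, Continuous (X' · ω) := by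
    filter_upwards [hZ'c, hX'Z'] with ω hω hωX
    have : (X' · ω) = (Z' · ω) := funext hωX
    rw [this]; exact hω
  -- `Yₙ → J - J' = X - X'` u.c.p.
  have hD : ∀ᵐ ω ∂Literature.Probability.Process.preWienerMeasure, ∀ t, X t ω - X' t ω = J t ω - J' t ω := by
    filter_upwards [hXZ, hX'Z', hZeq, hZ'eq] with ω h1 h2 h3 h4 t
    rw [h1 t, h2 t, h3 t, h4 t]
    ring
  have hucp : Literature.Probability.Process.TendstoUCP (fun n ↦ sampleDiffIntegral hXa hX'a n) (fun t ω ↦ X t ω - X' t ω)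
      Literature.Probability.Process.preWienerMeasure :=
    (hJucp.sub hJ'ucp).congr_right hD
  -- `D_T = 0` a.s. for every `T`, hence for all rational times simultaneously
  have hT : ∀ T, ∀ᵐ ω ∂Literature.Probability.Process.preWienerMeasure, X T ω - X' T ω = 0 := fun T ↦
    ae_sub_eq_zero_of_tendstoUCP hXa hX'a hXc hX'c hucp T
  have hQ : ∀ᵐ ω ∂Literature.Probability.Process.preWienerMeasure, ∀ q : ℚ, X ((q : ℝ).toNNReal) ω - X' ((q : ℝ).toNNReal) ω = 0 :=
    ae_all_iff.2 fun q ↦ hT _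
  filter_upwards [hQ, hXc, hX'c, hXZ, hX'Z'] with ω hq hc hc' h1 h2 t
  have hcont : Continuous fun s ↦ X s ω - X' s ω := hc.sub hc'
  have hzero : (fun s ↦ X s ω - X' s ω) = 0 := by
    refine Continuous.ext_on denseRange_toNNReal_ratCast hcont continuous_const ?_
    rintro _ ⟨q, rfl⟩
    exact hq q
  have := congrFun hzero t
  simp only [Pi.zero_apply] at this
  rw [← h1 t, ← h2 t]
  linarith

end Assembly

end Literature.Analysis.FunctionSpaces
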